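import Summits.QuantumFields.YangMills.Theorems.BalabanUVNodesN08AlphaEq324RowClassSocketEndUnitRange
import Literature.MathematicalPhysics.QuantumFieldTheory.Balaban1983to89.B1Eq324BenfattoClassMarginalTilt

/-!
# Route «BalabanUVNodes», Track-A DAG node N08 = [Balaban1985UV3] Thm 1 p. 257 ∕ Thm 2 p. 272 — THE CLASS SOCKET FED BY ONE LAW PER STEP: the (α)-row `h324`
# at EVERY history and background from a SINGLE presentation `(𝔖 k).μ = 𝒩(0,K)∘Φ⁻¹` of the step's h-independent fluctuation law, the history∕background
# dependence of print's `dμ_{C^{(k)}}` carried by the potential as the quadratic TILT + constant of the class road's `…ClassMarginalTilt` (part 14 of the socket)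

Cell `pub-ymgap`, seat `pub-ymgap-dag-n08-d` gen 22 (OFFER-80; first refusal to seat n08-w4's successor given on the bus).  `bears_on: R4∕N08`; filed
`--supports stmt-QuantumFields-27364` (K1⁹, helper).  THEOREMS ONLY (def-free, sorry-free, standard axioms); seat n08-w4's parts 1–13
(`…RowClassSocket*`, `…RowCumLetter*`) and the Literature road are consumed BY NAME and left untouched.

WHY (seat n08-w4 g6's located CHECK E, `N08-SOCKET-END-A6-g6.md` §9; seat n08-b g17's CHECK-E-MARGINAL; seat n08-d g22's
`Literature/…/B1Eq324BenfattoClassMarginalTilt`, p655217).  The carrier types ONE fluctuation law `(𝔖 k).μ` per step (ruling R-324) while print's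
`dμ_{C^{(k)}}` ([Balaban1985UV3] (58) p. 270) depends on `(h, U)` in dimension and covariance.  Parts 1–13 present the block per `(h, U)` by a law
`μ h U`; this part presents it by ONE lattice law `𝒩(0,K)` and ONE map `Φ` for all `(h, U)`, the `(h, U)`-dependence sitting where the carrier has room
for it — in `box h` (print's region box `{|z_x| ≤ p(g_k), x ∈ I h}`, pulled back a.e.) and in `𝒱 h U` (pulled back a.e. to
`H_{J h U} + Q_{h,U} + c_{h,U}`, `Q_{h,U}(z) = −½Σ_{u,v∈I}(A₁(h,U) − S(h))_{uv}z_u z_v` the tilt from the marginal precision `S(h) = (K_{II})⁻¹` to the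
region member `A₁(h,U)`, `c_{h,U} = log(Z_{S}/Z_{A₁})`).  By the Literature identity `integral_printBox_exp_tilt_hamiltonian_eq` the block integral IS
the road's `∫ Π_Δχ̂^I_pΔ e^{H_J} d𝒩(0,K₁(h,U))`, so the road's (3.24) for the region member gives the row `h324` at print's cumulant letter
`c k h U n := ℰ^T_{𝒩(0,K₁(h,U))}(H_{J h U}; n)` — with NO class row asked of the one law `K` (any positive definite `A` on any `Λ₀ ⊇ I h U`).
* §1 ★ `h324RowAt_of_onePresentation_ae` — the plug at an ARBITRARY letter from ONE presenting law: per `(h, U)` an a.e. pulled-back cut-off set `T h U`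
  and potential `W h U`, and the pair `0 < ∫_{T} e^{W} dμ`, `|log ∫_{T} e^{W} dμ − Σ_{n≤n̄} c h U n∕n!| ≤ C·g_k^{6+2κ₀}·|I h U|` with `|I h U| ≤ v·|T₁^{(k)}|`,
  `C·v ≤ Ca + Cc` ⟹ the row at `c` (n08-w4's `…RowCumLetter.h324RowAt_of_abs_log_le` + `…RowCumLetterModel.setIntegral_exp_map_eq` ∕ `budget_le_vol`).
* §2 ★★★★ `exists_threshold_h324Row_tilted_allSteps_ae` — THE END: class scalars `(d, γ_A, K_A, κ_A, D, ϰ, p₀, σ, c₀)` with `6 + 2κ₀ < σ(n̄ + 1)` first;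
  `∃ b₁ ∀ b₀ > b₁ ∃ C ≥ 0`; then for every `S`, tower data `𝔖`, step `k ≤ K`, budget `C·v ≤ Ca + Cc`, ONE law `(Λ₀, A, K)` (`A` positive definite —
  nothing else) with ONE measurable `Φ` and `(𝔖 k).μ = 𝒩(0,K)∘Φ⁻¹`, and per `(h, U)`: a region `∅ ≠ I h U ⊆ Λ₀` with `|I h U| ≤ v·|T₁^{(k)}|`, a region
  member `(I, A₁, K₁)(h,U)` in the class, letters `H_{J h U}` (`J ⊆ I`, `sup|coeff| ≤ c₀ g_k^σ`), the tilt `Q h U` read off its formula, the a.e. box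
  identity with print's region box at `p(g_k) = B10.pFun b₀ p₀ g_k` and the a.e. potential identity `𝒱 h U ∘ Φ = H_J + Q + log(Z_S/Z_{A₁})` ⟹
  `∀ h U, Eq324 (∫_{box h} e^{𝒱 h U} d(𝔖 k).μ) (n ↦ ℰ^T_{𝒩(0,K₁(h,U))}(H_{J h U}; n)) n̄ (Ca + Cc) (Lᵏg₀²) (3 + κ₀) |T₁^{(k)}|`.
HONEST SCOPE.  Hypothesis-shape bookkeeping + two compositions by name; which `(Λ₀, A, K, Φ)` NODE 00 pins as `(𝔖 k).μ` (at the trivial background the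
presented `C*Δ_kC` of `…ClassTorusGaugeFluctuation` on all free bonds is available hypothesis-free), which regions and members `A₁(h,U)` (N06's Sect.-E rows
at a general background), and whether the OTHER (α)-rows tolerate the tilted potential are NOT decided here; nothing of [Balaban1985UV3] ∕ [BenfattoEtAl1978]
asserted or discharged; `PrintedUV3V` NOT proved; N08 NOT discharged; count-neutral; one finite 𝕋⁴ programme at fixed ε — R4 closes the conditional
finite-𝕋⁴ rung `BalabanLadder.UV` only; nothing continuum ∕ ℝ⁴ ∕ OS ∕ mass gap ∕ Clay.

References: [Balaban1985UV3] T. Bałaban, CMP 102 (1985) 255–275 — (58) p. 270, (24) p. 262, (41) p. 266; [Balaban1982Higgs1] T. Bałaban, CMP 85 (1982)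
603–636 — (3.24) p. 616; [BenfattoEtAl1978] G. Benfatto et al., CMP 59 (1978) 143–166 — Lemma p. 152; [Balaban1985BackgroundPropagators] T. Bałaban,
CMP 99 (1985) 389–434 — Sect. E p. 428.
-/

noncomputable section

namespace Summit.QuantumFields.YangMills.Theorems.BalabanUVNodesN08AlphaEq324RowClassSocketEndTilted

open MeasureTheory
open scoped BigOperators Nat
open Literature.MathematicalPhysics.QuantumFieldTheory (gaussianFieldOfKernel covGram)
open Literature.MathematicalPhysics.QuantumFieldTheory.GaussianToolkit (gaussZ)
open Literature.MathematicalPhysics.QuantumFieldTheory.Balaban1983to89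
open Literature.MathematicalPhysics.QuantumFieldTheory.Balaban1983to89.B1Sect3Statements (Eq324)
open Literature.MathematicalPhysics.QuantumFieldTheory.Balaban1983to89.B1Eq324BenfattoLemma
  (Coef hamiltonian coefSup smallFieldSet cutoffBoltzmann truncatedExp cumulantSum)
open Literature.MathematicalPhysics.QuantumFieldTheory.Balaban1983to89.B1Eq324BenfattoClassMarginalTilt
  (eq324_tilt_of_expDecay_on_unit measurableSet_printBox)
open Literature.MathematicalPhysics.QuantumFieldTheory.Balaban1985CMP102.Setting
open Summit.QuantumFields.Balaban3D.Carriers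
open Summit.QuantumFields.Balaban3D.Proofs.ScalesArithmetic (gk_pos gk_le_one g0sq_pos L_pos sites_nonneg)
open Summit.QuantumFields.Balaban3D.Proofs.Primitives (AlphaConsts)
open Summit.QuantumFields.Balaban3D.Proofs.GroupModelLieC (lieC)
open Summit.QuantumFields.YangMills.Theorems.BalabanUVNodesN08AlphaEq324RowCumLetterModel (budget_le_vol gk_rpow_six_add setIntegral_exp_map_eq)
open Summit.QuantumFields.YangMills.Theorems.BalabanUVNodesN08AlphaEq324RowCumLetter (h324RowAt_of_abs_log_le)

variable {L : ℕ} {G : Type} [GaugeGroup G] [MeasurableSpace G] [HaarData G] (𝔊 : GroupModel G) (𝔠 : AlphaConsts L 𝔊.N) {d : ℕ}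

/-! ## §1 The plug at an arbitrary cumulant letter from ONE presenting lattice law -/

section Plug

variable {S : Scales L} (𝔖 : ∀ k, StepSeries S G ↥(lieC 𝔊) (nblkOf S 𝔠.lane.carrier k) k) (k : ℕ)

/-- ★ **THE (3.24) ROW AT AN ARBITRARY LETTER FROM ONE PRESENTATION OF THE STEP's LAW.**  If `(𝔖 k).μ = μ∘Φ⁻¹` for ONE lattice law `μ` and ONE measurable
`Φ` (boxes and potentials measurable), and per `(h, U)` the box pulls back a.e. to a set `T h U`, the potential pulls back a.e. to `W h U`, the lattice integral
`∫_{T h U} e^{W h U} dμ` is positive with `|log ∫_{T h U} e^{W h U} dμ − Σ_{n=1}^{n̄} c h U n∕n!| ≤ C·g_k^{6+2κ₀}·|I h U|`, `|I h U| ≤ v·|T₁^{(k)}|` and `C·v ≤ Ca + Cc`,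
then the row `h324` holds at the letter `c`: `∀ h U, Eq324 (∫_{box h} e^{𝒱 h U} d(𝔖 k).μ) (c h U) n̄ (Ca + Cc) (Lᵏg₀²) (3 + κ₀) |T₁^{(k)}|`.
[cite: Balaban1985UV3, (41) p.266, (58) p.270; Balaban1982Higgs1, (3.24) p.616 (bookkeeping)] -/
theorem h324RowAt_of_onePresentation_ae {v C : ℝ} (hC : 0 ≤ C) (hCv : C * v ≤ 𝔠.Ca + 𝔠.Cc)
    (μ : Measure ((Fin d → ℤ) → ℝ)) (Φ : ((Fin d → ℤ) → ℝ) → (𝔖 k).Fl) (hΦ : Measurable Φ) (hμ : (𝔖 k).μ = μ.map Φ)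
    (hboxm : ∀ h, MeasurableSet ((𝔖 k).box h)) (hVm : ∀ h U, Measurable ((𝔖 k).𝒱 h U))
    (T : Hist S.P (k + 1) → GaugeField S.P (k + 1) G → Set ((Fin d → ℤ) → ℝ))
    (hbox : ∀ h (U : GaugeField S.P (k + 1) G), Φ ⁻¹' (𝔖 k).box h =ᵐ[μ] T h U)
    (W : Hist S.P (k + 1) → GaugeField S.P (k + 1) G → ((Fin d → ℤ) → ℝ) → ℝ)
    (hV : ∀ h U, (fun z => (𝔖 k).𝒱 h U (Φ z)) =ᵐ[μ] W h U)
    (I : Hist S.P (k + 1) → GaugeField S.P (k + 1) G → Finset (Fin d → ℤ)) (hI : ∀ h U, ((I h U).card : ℝ) ≤ v * S.sites k)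
    (c : Hist S.P (k + 1) → GaugeField S.P (k + 1) G → ℕ → ℝ)
    (hout : ∀ h U, 0 < ∫ z in T h U, Real.exp (W h U z) ∂μ ∧
      |Real.log (∫ z in T h U, Real.exp (W h U z) ∂μ) - ∑ n ∈ Finset.Icc 1 𝔠.nbar, c h U n / (n ! : ℝ)| ≤
        C * S.gk k ^ (6 + 2 * 𝔠.κ₀) * (I h U).card) :
    ∀ h (U : GaugeField S.P (k + 1) G), Eq324 (∫ ω in (𝔖 k).box h, Real.exp ((𝔖 k).𝒱 h U ω) ∂(𝔖 k).μ)
      (c h U) 𝔠.nbar (𝔠.Ca + 𝔠.Cc) ((L : ℝ) ^ k * S.g0sq) (3 + 𝔠.κ₀) (S.sites k) := by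
  have hint : ∀ h (U : GaugeField S.P (k + 1) G),
      ∫ ω in (𝔖 k).box h, Real.exp ((𝔖 k).𝒱 h U ω) ∂(𝔖 k).μ = ∫ z in T h U, Real.exp (W h U z) ∂μ := by
    intro h U
    rw [hμ, setIntegral_exp_map_eq μ hΦ (hboxm h) (hVm h U), setIntegral_congr_set (hbox h U)]
    exact integral_congr_ae (ae_restrict_of_ae ((hV h U).mono fun z hz => by simp only [← hz]))
  refine h324RowAt_of_abs_log_le 𝔊 𝔠 𝔖 k c (fun h U => C * S.gk k ^ (6 + 2 * 𝔠.κ₀) * (I h U).card)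
    (fun h U => ?_) (fun h U => ?_) (fun h U => ?_)
  · rw [hint]; exact (hout h U).1
  · rw [hint]; exact (hout h U).2
  · rw [gk_rpow_six_add]
    exact budget_le_vol hC (mul_pos (pow_pos (L_pos S) k) (g0sq_pos S)) (sites_nonneg S k) (hI h U) hCv

end Plug

/-! ## §2 The END: ONE law per step, the region members tilted in the potential -/

/-- ★★★★ **THE (3.24) ROW AT EVERY RUN STEP FROM ONE LAW PER STEP, THE `(h, U)`-DEPENDENCE OF PRINT's `dμ_{C^{(k)}}` CARRIED BY THE TILTED POTENTIAL.**
`b₁` depends only on the class scalars `(d, γ_A, K_A, κ_A, D, ϰ, p₀, σ, c₀, n̄, κ₀)`; for `b₀ > b₁` the constant `C` on those and `b₀`.  Per step: ONE positive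
definite `A` on ONE window `Λ₀ ⊂ ℤ^d` with zero-extended inverse `K`, ONE measurable `Φ`, `(𝔖 k).μ = 𝒩(0,K)∘Φ⁻¹` — no class row asked of `A`.  Per `(h, U)`:
a region `∅ ≠ I h U ⊆ Λ₀`, a class member `A₁ h U` on it (symmetric, `γ_A`-coercive, `K_A e^{−κ_A|·|₂}`) with zero-extended inverse `K₁ h U`, letters
`H_{J h U}` (`J ⊆ I`, `sup|coeff| ≤ c₀·g_k^σ`), the tilt `Q h U z = −½Σ_{u,v∈I}(A₁ h U − (K_{II})⁻¹)_{uv} z_u z_v`, and the a.e. identities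
`Φ⁻¹'(box h) =ᵐ {∀x∈I h U, |z_x| ≤ p(g_k)}`, `𝒱 h U ∘ Φ =ᵐ H_{J h U} + Q h U + log(Z_{(K_{II})⁻¹}/Z_{A₁ h U})` ⟹ the row at print's letter
`n ↦ ℰ^T_{𝒩(0,K₁ h U)}(H_{J h U}; n)`.  Proof: seat n08-d's `…ClassMarginalTilt.eq324_tilt_of_expDecay_on_unit` at `η := g_k` ∘ §1.
[cite: Balaban1985UV3, (5) p.256 + (7) p.257 + (41) p.266 + (58) p.270; Balaban1982Higgs1, (3.24) p.616; BenfattoEtAl1978, Lemma p.152 (class form; ours);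
Balaban1985BackgroundPropagators, Sect. E p.428] -/
theorem exists_threshold_h324Row_tilted_allSteps_ae (hd : 0 < d) {γA KA κA : ℝ} (hγA0 : 0 < γA) (hKA : 0 ≤ KA) (hκA : 0 < κA)
    (D : ℕ) {ϰ : ℝ} (hϰ : 0 < ϰ) {p₀ σ c₀ : ℝ} (hp₀ : 2 / 3 < p₀) (hσ : 0 < σ) (hc₀ : 0 ≤ c₀) (hκσ : 6 + 2 * 𝔠.κ₀ < σ * (𝔠.nbar + 1)) :
    ∃ b₁ : ℝ, ∀ b₀ : ℝ, b₁ < b₀ → ∃ C : ℝ, 0 ≤ C ∧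
      ∀ (S : Scales L) (𝔖 : ∀ k, StepSeries S G ↥(lieC 𝔊) (nblkOf S 𝔠.lane.carrier k) k) (k : ℕ), k ≤ S.K → ∀ (v : ℝ), C * v ≤ 𝔠.Ca + 𝔠.Cc →
        -- ONE law per step: a positive definite `A` on `Λ₀`, its zero-extended inverse `K`, one presentation map `Φ`
        ∀ (Λ₀ : Finset (Fin d → ℤ)) (A : Matrix ↥Λ₀ ↥Λ₀ ℝ) (K : (Fin d → ℤ) → (Fin d → ℤ) → ℝ) (Φ : ((Fin d → ℤ) → ℝ) → (𝔖 k).Fl),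
          (∀ x y, K x y = if hxy : x ∈ Λ₀ ∧ y ∈ Λ₀ then (A⁻¹ : Matrix ↥Λ₀ ↥Λ₀ ℝ) ⟨x, hxy.1⟩ ⟨y, hxy.2⟩ else 0) → A.PosDef →
          Measurable Φ → (𝔖 k).μ = (gaussianFieldOfKernel K).map Φ →
          (∀ h, MeasurableSet ((𝔖 k).box h)) → (∀ h U, Measurable ((𝔖 k).𝒱 h U)) →
        -- per `(h, U)`: region, region member, letters, tilt
        ∀ (I : Hist S.P (k + 1) → GaugeField S.P (k + 1) G → Finset (Fin d → ℤ)) (hI : ∀ h U, I h U ⊆ Λ₀)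
          (A₁ : ∀ h U, Matrix ↥(I h U) ↥(I h U) ℝ) (K₁ : Hist S.P (k + 1) → GaugeField S.P (k + 1) G → (Fin d → ℤ) → (Fin d → ℤ) → ℝ)
          (s : ℕ) (J : Hist S.P (k + 1) → GaugeField S.P (k + 1) G → Finset (Fin d → ℤ))
          (a : Hist S.P (k + 1) → GaugeField S.P (k + 1) G → Coef d)
          (Q : Hist S.P (k + 1) → GaugeField S.P (k + 1) G → ((Fin d → ℤ) → ℝ) → ℝ),
          (∀ h U x y, K₁ h U x y = if hxy : x ∈ I h U ∧ y ∈ I h U then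
            ((A₁ h U)⁻¹ : Matrix ↥(I h U) ↥(I h U) ℝ) ⟨x, hxy.1⟩ ⟨y, hxy.2⟩ else 0) →
          (∀ h U, (I h U).Nonempty) → (∀ h U e e', A₁ h U e e' = A₁ h U e' e) →
          (∀ h U (x : ↥(I h U) → ℝ), γA * ∑ e, x e ^ 2 ≤ ∑ e, ∑ e', A₁ h U e e' * x e * x e') →
          (∀ h U (e e' : ↥(I h U)), |A₁ h U e e'| ≤
            KA * Real.exp (-(κA * Real.sqrt (∑ j, ((((e : Fin d → ℤ) j : ℝ) - ((e' : Fin d → ℤ) j : ℝ))) ^ 2)))) →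
          (∀ h U, J h U ⊆ I h U) → (∀ h U, coefSup s D (a h U) (J h U) ≤ c₀ * S.gk k ^ σ) →
          (∀ h U z, Q h U z = -(1 / 2) * ∑ u : ↥(I h U), ∑ v : ↥(I h U),
            (A₁ h U u v - (covGram K (I h U))⁻¹ u v) * z u * z v) →
          -- the a.e. presentation of box and potential, and the budget
          (∀ h U, Φ ⁻¹' (𝔖 k).box h =ᵐ[gaussianFieldOfKernel K]
            {z : (Fin d → ℤ) → ℝ | ∀ x ∈ I h U, |z x| ≤ B10.pFun b₀ p₀ (S.gk k)}) →
          (∀ h U, (fun z => (𝔖 k).𝒱 h U (Φ z)) =ᵐ[gaussianFieldOfKernel K] fun z =>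
            hamiltonian s D ϰ (a h U) (J h U) z + Q h U z +
              Real.log ((gaussZ (covGram K (I h U))⁻¹).toReal / (gaussZ (A₁ h U)).toReal)) →
          (∀ h U, ((I h U).card : ℝ) ≤ v * S.sites k) →
          ∀ h (U : GaugeField S.P (k + 1) G),
            Eq324 (∫ ω in (𝔖 k).box h, Real.exp ((𝔖 k).𝒱 h U ω) ∂(𝔖 k).μ)
              (fun n => truncatedExp (gaussianFieldOfKernel (K₁ h U)) (hamiltonian s D ϰ (a h U) (J h U)) n) 𝔠.nbar (𝔠.Ca + 𝔠.Cc)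
              ((L : ℝ) ^ k * S.g0sq) (3 + 𝔠.κ₀) (S.sites k) := by
  obtain ⟨b₁, hb₁⟩ :=
    eq324_tilt_of_expDecay_on_unit (d := d) hd hγA0 hKA hκA 𝔠.nbar D hϰ hp₀ hσ hc₀ (κ := 6 + 2 * 𝔠.κ₀) (by linarith [𝔠.κ₀_pos]) hκσ
  refine ⟨b₁, fun b₀ hb => ?_⟩
  obtain ⟨C, hC, hE⟩ := hb₁ b₀ hb
  refine ⟨C, hC, ?_⟩
  intro S 𝔖 k hk v hCv Λ₀ A K Φ hK hA hΦ hμ hboxm hVm I hI A₁ K₁ s J a Q hK₁ hIne hAs hγA hdec hJI hcoef hQ hbox hV hIv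
  refine h324RowAt_of_onePresentation_ae 𝔊 𝔠 𝔖 k hC hCv (gaussianFieldOfKernel K) Φ hΦ hμ hboxm hVm
    (fun h U => {z : (Fin d → ℤ) → ℝ | ∀ x ∈ I h U, |z x| ≤ B10.pFun b₀ p₀ (S.gk k)}) hbox
    (fun h U z => hamiltonian s D ϰ (a h U) (J h U) z + Q h U z +
      Real.log ((gaussZ (covGram K (I h U))⁻¹).toReal / (gaussZ (A₁ h U)).toReal)) hV I hIv
    (fun h U n => truncatedExp (gaussianFieldOfKernel (K₁ h U)) (hamiltonian s D ϰ (a h U) (J h U)) n) fun h U => ?_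
  have hrow := hE (S.gk k) (gk_pos S k) (gk_le_one S S.gK_le_one k hk) hK hA (hK₁ h U) (hI h U) (hIne h U) (hAs h U) (hγA h U)
    (hdec h U) s (J h U) (a h U) (hJI h U) (hcoef h U) (hQ h U)
  rw [integral_indicator (measurableSet_printBox (I h U) (B10.pFun b₀ p₀ (S.gk k)))] at hrow
  simpa only [cumulantSum] using hrow

end Summit.QuantumFields.YangMills.Theorems.BalabanUVNodesN08AlphaEq324RowClassSocketEndTilted

end
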